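import Mathlib
import Literature.NumberTheory.LFunctions.Zhang2022.Section11E2MeanSquare
import Literature.NumberTheory.LFunctions.Zhang2022.Section4Prop22Eventually
import Literature.NumberTheory.LFunctions.Zhang2022.Section7Prop71Holds
import HarnessLib

/-!
# Zhang (2022) §11 p. 64: the window mean square `Step11u019` reduced to the arithmetic sums `S_j`
# of Proposition 7.1 (the mean-value half of "by (11.3), (8.25), (8.26)")

Topic `Literature/NumberTheory/LFunctions/Zhang2022` (Landau–Siegel audit tree; verdict-neutral).
Y. Zhang, *Discrete mean estimates and the Landau–Siegel zero*, arXiv:2211.02515v1 (2022)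
[Zhang2022LandauSiegel] — **an unrefereed manuscript under adjudication; nothing here asserts or
denies its Theorems 1–2.** §11 p. 64 (tex L3295–L3301) claims, "by (11.3), (8.25) and (8.26)", that the
weighted discrete mean square over the zeros of the short sums
`Σ_{n∈𝔍₁} χψ(n)n^{−ρ}(f̃(log n/log P) − g̃₁(n))` is `o(𝔞𝔓)` (typed CLAIM
`Typed.TypedSection11B.Step11u019`, DAG `Z22:§11.u019`). The displays "(8.25), (8.26)" do not exist
in v1 (cell GAP row G-L3t10-1). This file proves the MEAN-VALUE HALF of that sentence as kernel
implications (no new definitions, no facts; the companion file `Section11WindowMeanSquareJ2` does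
the same for the unprinted `J₂`-twin `Step11u019J2` behind "Similarly"):

* `meanSquare_le_of_lemma81_prop71` — **the general discrete mean square from Lemma 8.1 and
  Proposition 7.1**: for every bound `B` and `ε > 0` there is `C ≥ 0` with, for `D` large under (A)
  and every sequence `𝐚` admissible for (7.2) (`Skeleton.Adm72 D B 𝐚`),
  `ΣΣ Re 𝔠*(ρ,ψ)·|A(𝐚;ρ,ψ)|²·Re ω(ρ) ≤ 2‖α⁻¹(½S₁+2S₂+3/2S₃)(𝐚,𝐚̄)𝔓‖ + C·E(𝐚,𝐚̄) + ε𝔓`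
  (on the critical line `A(𝐚̄;1−ρ,ψ̄) = conj A(𝐚;ρ,ψ)`, Prop. 2.2 (i); the weights are real and
  non-negative, Lemma 2.3). The tree's `Section11E2MeanSquare.dmv_of_lemma81_prop71` is the special
  case in which `|S_j| ≤ K𝓛^B` is assumed for all sequences bounded by `1`; here the dependence on
  `S_j(𝐚,𝐚̄)` is kept, which is what short sums need.
* `meanSquare_small_of_sj` — hence, with `𝔞 ≫ 1`: **for any family `𝐚_{D,χ}` of admissible
  sequences with `𝓛⁹·S_j(𝐚,𝐚̄) → 0` (`j = 1,2,3`), the mean square is `o(𝔞𝔓)`** (`α⁻¹ = 𝓛⁹/π`,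
  `E = 𝔓𝓛²Σ|S_j|`).
* the window sequence of §11: `𝐚 = χ(n)1_{𝔍₁}(n)(f̃(log n/log P) − g̃₁(n))` (written inline) is
  admissible for (7.2) with `B = 3` (`|f̃| ≤ 1`, `0 < g < 1` so `|g̃₁| ≤ 2`; `𝔍₁ ⊂ (0, P₁η₊)`,
  `P₁η₊ < PT⁻²` for `𝓛 ≥ 2`), and `A(𝐚;s,ψ)` IS the sum `Σ_{n∈𝔍₁}…` of (11.5)
  (`Apoly_window_eq_frakI1Sum`).
* `step11u019_of_sjWindow` — **the leaf from an `S_j`-estimate**: Lemma 2.3, Prop. 2.2 (i),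
  Lemma 8.1, Prop. 7.1, `𝔞 ≫ 1` and "`𝓛⁹·S_j(𝐚,𝐚̄) → 0` (`j = 1,2,3`)" for the window sequence
  imply `Step11u019 c′`; `step11u019_of_sjWindow_eventually : ∃ c₀ ≥ 0, ∀ c′ ≥ c₀,
  (S_j-hypothesis) → Step11u019 c′` over the tree theorems `Skeleton.prop22i_holds`,
  `lemma23_eventually`, `lemma81_eventually`, `Section7cStatements.prop71X_holds`,
  `frakALowerBound_holds` — i.e. the leaf is REDUCED to a statement about the finite arithmetic sums
  `S_j` of the window sequence (no zeros, no `𝔠*`, no `ω` left).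

What is deliberately NOT here: the arithmetic half — the estimate of `S_j` at the window sequence
(§11's "simple estimates"; it needs the cancellation in `ξ₀ⱼ` and in `χ`, cf. Lemmas 8.4 / 10.2, and is
a manuscript step to be proved in its own file). 0 new definitions, 0 facts; standard axioms.

## References

* Y. Zhang, arXiv:2211.02515v1 (2022), §11 p. 64 (tex L3295–L3301); §7 Prop. 7.1, (7.2); §8
  Lemma 8.1; §2 Lemma 2.3, Prop. 2.2 (i). [cite: Zhang2022LandauSiegel, §11 p. 64]
-/

noncomputable section

open Complex Real ComplexConjugate

namespace Literature.NumberTheory.LFunctions.Zhang2022.Section11WindowMeanSquare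

open Literature.NumberTheory.LFunctions.Zhang2022.Skeleton
open Literature.NumberTheory.LFunctions.Zhang2022.Typed.TypedSection11B
open Literature.NumberTheory.LFunctions.Zhang2022.Section11E2MeanSquare

/-! ### Elementary facts -/

/-- `log D ≥ 2` once `D ≥ 8`. [folklore] -/
private theorem two_le_log_of_eight_le {D : ℕ} (hD : 8 ≤ D) : 2 ≤ Real.log D := by
  have h8 : (8 : ℝ) ≤ D := by exact_mod_cast hD
  have h2 : (2 : ℝ) ≤ Real.log 8 := by
    rw [Real.le_log_iff_exp_le (by norm_num)]
    have h1 := Real.exp_one_lt_d9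
    have h0 := Real.exp_pos 1
    have hsq : Real.exp 2 = Real.exp 1 * Real.exp 1 := by rw [← Real.exp_add]; norm_num
    rw [hsq]
    nlinarith
  exact h2.trans (Real.log_le_log (by norm_num) h8)

section General

variable (c' : ℝ) {D : ℕ} [NeZero D] (χ : DirichletCharacter ℂ D)

omit [NeZero D] in
/-- An index of the double sum `ΣΣ` of (2.16) is a pair `(ψ, ρ)` with `ψ ∈ Ψ₁`, `ρ ∈ 𝔷(ψ)`.
[cite: Zhang2022LandauSiegel, §2 (2.16)] -/
private theorem mem_idx {i : (_ : Chr D) × ℂ} (hi : i ∈ idx χ) :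
    i.1 ∈ PsiOne χ ∧ i.2 ∈ zeroSet D i.1 := by
  rw [idx, Finset.mem_sigma] at hi
  exact ⟨mem_of_mem_finsetOf hi.1, mem_of_mem_finsetOf hi.2⟩

/-! ### The general discrete mean square from Lemma 8.1 and Proposition 7.1 -/

/-- **The discrete mean square over the zeros from Lemma 8.1 + Proposition 7.1, with the
`S_j`-dependence explicit.** For every `B` and `ε > 0` there is `C ≥ 0` such that, for `D` large under
(A) and every `𝐚` admissible for (7.2) with bound `B`,
`ΣΣ Re𝔠*(ρ,ψ)|A(𝐚;ρ,ψ)|² Re ω(ρ) ≤ 2‖mainMV(𝐚,𝐚̄)‖ + C·E(𝐚,𝐚̄) + ε𝔓`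
(`mainMV = α⁻¹(½S₁+2S₂+3/2S₃)𝔓`, `E = 𝔓𝓛²Σ|S_j|`; on the critical line the left side of Lemma 8.1
at `(𝐚, 𝐚̄)` is this mean square, and `Θ₁(𝐚,𝐚̄) + conj Θ₁(𝐚,𝐚̄)` has norm `≤ 2‖Θ₁‖`).
[cite: Zhang2022LandauSiegel, §11 p. 64; §8 Lemma 8.1; §7 Prop. 7.1] -/
theorem meanSquare_le_of_lemma81_prop71 (h23 : Lemma23 c') (h22 : Prop22i) (h81 : Lemma81 c')
    (h71 : Prop71 c') (B ε : ℝ) (hε : 0 < ε) :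
    ∃ C : ℝ, 0 ≤ C ∧ ForAllLarge fun D _ χ => AssumptionA D χ → ∀ a : ℕ → ℂ, Adm72 D B a →
      ∑ i ∈ idx χ, (cstar c' D i.1 i.2).re * ‖Apoly i.1 a i.2‖ ^ 2 * (omegaW D i.2).re
        ≤ 2 * ‖mainMV c' D a (fun n => conj (a n))‖ +
          C * Ecal c' D a (fun n => conj (a n)) + ε * frakP D := by
  have hε3 : 0 < ε / 3 := by positivity
  obtain ⟨C, D₁, h71'⟩ := h71 B (ε / 3) hε3
  obtain ⟨D₀, h⟩ := (h22.and h23).and (h81 B (ε / 3) hε3)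
  refine ⟨2 * |C|, by positivity, max (max D₀ D₁) 8, fun D _ χ hD hq hp hA a hadm => ?_⟩
  have hD8 : 8 ≤ D := le_trans (le_max_right _ _) hD
  have hD3 : 3 ≤ D := le_trans (by norm_num) hD8
  obtain ⟨⟨h22', h23'⟩, h81'⟩ :=
    h D χ (le_trans (le_trans (le_max_left _ _) (le_max_left _ _)) hD) hq hp
  have h71D := h71' D χ (le_trans (le_trans (le_max_right _ _) (le_max_left _ _)) hD) hq hp hA
  set b : ℕ → ℂ := fun n => conj (a n) with hb_def
  have hbdm : Adm72 D B b := adm72_conj hadm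
  have hba : (fun n => conj (b n)) = a := by funext n; simp [hb_def]
  -- pointwise facts at the zeros
  have mem : ∀ i ∈ idx χ, i.1 ∈ PsiOne χ ∧ i.2 ∈ zeroSet D i.1 := fun i hi => mem_idx χ hi
  have hre : ∀ i ∈ idx χ, i.2.re = 1 / 2 := fun i hi =>
    h22' i.1 (mem i hi).1 i.2 (mem_prodZeroSetOmega_of_mem_zeroSet χ (mem i hi).2)
  have hcIm : ∀ i ∈ idx χ, (cstar c' D i.1 i.2).im = 0 := fun i hi =>
    (h23' i.1 (mem i hi).1 i.2 (mem i hi).2).1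
  have hωIm : ∀ i ∈ idx χ, (omegaW D i.2).im = 0 := fun i hi => (omegaW_re_pos hD3 (hre i hi)).2
  -- Lemma 8.1 and Prop 7.1 at (a, b)
  have k81 := h81' hA a b hadm hbdm
  rw [hba] at k81
  have k71 := h71D a b hadm hbdm
  have hP : 0 ≤ frakP D := frakP_nonneg D
  have hE0 : 0 ≤ Ecal c' D a b := by rw [Ecal]; positivity
  -- the left side of Lemma 8.1 is the mean square
  have hlhs : lhs81 c' χ a b = ∑ i ∈ idx χ, cstar c' D i.1 i.2 *
      ((‖Apoly i.1 a i.2‖ ^ 2 : ℝ) : ℂ) * omegaW D i.2 := lhs81_conj_eq c' χ a hre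
  have hre_sum : (lhs81 c' χ a b).re =
      ∑ i ∈ idx χ, (cstar c' D i.1 i.2).re * ‖Apoly i.1 a i.2‖ ^ 2 * (omegaW D i.2).re := by
    rw [hlhs, Complex.re_sum]
    refine Finset.sum_congr rfl fun i hi => ?_
    rw [Complex.mul_re, Complex.mul_re, Complex.mul_im, hcIm i hi, hωIm i hi, Complex.ofReal_re,
      Complex.ofReal_im]
    ring
  have hΘ : ‖Theta1 c' χ a b‖ ≤ ‖mainMV c' D a b‖ + (|C| * Ecal c' D a b + ε / 3 * frakP D) := by
    have h1 : ‖Theta1 c' χ a b‖ ≤ ‖mainMV c' D a b‖ + ‖Theta1 c' χ a b - mainMV c' D a b‖ :=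
      norm_le_insert' _ _
    have h2 : C * Ecal c' D a b ≤ |C| * Ecal c' D a b :=
      mul_le_mul_of_nonneg_right (le_abs_self C) hE0
    linarith
  calc ∑ i ∈ idx χ, (cstar c' D i.1 i.2).re * ‖Apoly i.1 a i.2‖ ^ 2 * (omegaW D i.2).re
      = (lhs81 c' χ a b).re := hre_sum.symm
    _ ≤ ‖lhs81 c' χ a b‖ := Complex.re_le_norm _
    _ ≤ ‖Theta1 c' χ a b + conj (Theta1 c' χ a b)‖ +
          ‖lhs81 c' χ a b - (Theta1 c' χ a b + conj (Theta1 c' χ a b))‖ := norm_le_insert' _ _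
    _ ≤ (‖Theta1 c' χ a b‖ + ‖Theta1 c' χ a b‖) + ε / 3 * frakP D := by
        refine add_le_add (le_trans (norm_add_le _ _) ?_) k81
        rw [RCLike.norm_conj]
    _ ≤ 2 * (‖mainMV c' D a b‖ + (|C| * Ecal c' D a b + ε / 3 * frakP D)) + ε / 3 * frakP D := by
        linarith
    _ = 2 * ‖mainMV c' D a b‖ + 2 * |C| * Ecal c' D a b + ε * frakP D := by ring


/-- **A discrete mean square is `o(𝔞𝔓)` as soon as `𝓛⁹·S_j → 0`.** If `𝐚_{D,χ}` is a family of
sequences admissible for (7.2) with a common bound `B` (for `D` large) and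
`𝓛⁹‖S_j(𝐚,𝐚̄)‖ → 0` (`j = 1, 2, 3`, under (A)), then
`ΣΣ Re𝔠*(ρ,ψ)|A(𝐚;ρ,ψ)|² Re ω(ρ) = o(𝔞𝔓)` — from `meanSquare_le_of_lemma81_prop71`
(`α⁻¹ = 𝓛⁹/π`, `E = 𝔓𝓛²Σ|S_j| ≤ 𝓛⁻⁷·𝔓·𝓛⁹Σ|S_j|`) and `𝔞 ≫ 1`. This is the honest content of the
mean-value estimate that §11 p. 64 calls "(8.25), (8.26)".
[cite: Zhang2022LandauSiegel, §11 p. 64; §7 Prop. 7.1; §8 Lemma 8.1] -/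
theorem meanSquare_small_of_sj (h23 : Lemma23 c') (h22 : Prop22i) (h81 : Lemma81 c')
    (h71 : Prop71 c') (ha : FrakALowerBound) (B : ℝ)
    (aSeq : (D : ℕ) → DirichletCharacter ℂ D → ℕ → ℂ)
    (hadm : ForAllLarge fun D _ χ => Adm72 D B (aSeq D χ))
    (hS : ∀ ε : ℝ, 0 < ε → ForAllLarge fun D _ χ => AssumptionA D χ →
      ∀ j ∈ ({1, 2, 3} : Finset ℕ),
        ell D ^ 9 * ‖Sj c' D j (aSeq D χ) (fun n => conj (aSeq D χ n))‖ ≤ ε) :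
    ∀ ε : ℝ, 0 < ε → ForAllLarge fun D _ χ => AssumptionA D χ →
      ∑ i ∈ idx χ, (cstar c' D i.1 i.2).re * ‖Apoly i.1 (aSeq D χ) i.2‖ ^ 2 * (omegaW D i.2).re
        ≤ ε * frakA χ * frakP D := by
  intro ε hε
  obtain ⟨a₀, ha₀, ha⟩ := ha
  obtain ⟨C, hC0, hMS⟩ :=
    meanSquare_le_of_lemma81_prop71 c' h23 h22 h81 h71 B (ε * a₀ / 3) (by positivity)
  set ε₂ : ℝ := ε * a₀ / (3 * (3 + 3 * C)) with hε₂
  have hε₂0 : 0 < ε₂ := by positivity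
  obtain ⟨D₀, h⟩ := ((hMS.and (hS ε₂ hε₂0)).and ha).and hadm
  refine ⟨max D₀ 8, fun D _ χ hD hq hp hA => ?_⟩
  have hD8 : 8 ≤ D := le_trans (le_max_right _ _) hD
  have hlog := two_le_log_of_eight_le hD8
  have hℓ : 2 ≤ ell D := by rw [ell]; exact hlog
  have hℓ0 : 0 < ell D := by linarith
  obtain ⟨⟨⟨hMS', hS'⟩, ha'⟩, hadm'⟩ := h D χ (le_trans (le_max_left _ _) hD) hq hp
  set a : ℕ → ℂ := aSeq D χ with ha_def
  set b : ℕ → ℂ := fun n => conj (a n) with hb_def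
  have k : ∑ i ∈ idx χ, (cstar c' D i.1 i.2).re * ‖Apoly i.1 a i.2‖ ^ 2 * (omegaW D i.2).re ≤
      2 * ‖mainMV c' D a b‖ + C * Ecal c' D a b + ε * a₀ / 3 * frakP D := hMS' hA a hadm'
  have hS1 : ell D ^ 9 * ‖Sj c' D 1 a b‖ ≤ ε₂ := hS' hA 1 (by simp)
  have hS2 : ell D ^ 9 * ‖Sj c' D 2 a b‖ ≤ ε₂ := hS' hA 2 (by simp)
  have hS3 : ell D ^ 9 * ‖Sj c' D 3 a b‖ ≤ ε₂ := hS' hA 3 (by simp)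
  have hP : 0 ≤ frakP D := frakP_nonneg D
  have haA : a₀ ≤ frakA χ := ha' hA
  have hα : alpha D = π / ell D ^ 9 := by rw [alpha, bigP, Real.log_exp]
  -- the main term
  have hn1 : ‖(1 / 2 : ℂ) * Sj c' D 1 a b‖ = 1 / 2 * ‖Sj c' D 1 a b‖ := by rw [norm_mul]; norm_num
  have hn2 : ‖(2 : ℂ) * Sj c' D 2 a b‖ = 2 * ‖Sj c' D 2 a b‖ := by rw [norm_mul]; norm_num
  have hn3 : ‖(3 / 2 : ℂ) * Sj c' D 3 a b‖ = 3 / 2 * ‖Sj c' D 3 a b‖ := by rw [norm_mul]; norm_num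
  have hsum : ell D ^ 9 * ‖1 / 2 * Sj c' D 1 a b + 2 * Sj c' D 2 a b + 3 / 2 * Sj c' D 3 a b‖ ≤
      4 * ε₂ := by
    calc _ ≤ ell D ^ 9 * (‖1 / 2 * Sj c' D 1 a b‖ + ‖2 * Sj c' D 2 a b‖ + ‖3 / 2 * Sj c' D 3 a b‖) :=
          mul_le_mul_of_nonneg_left norm_add₃_le (by positivity)
      _ = 1 / 2 * (ell D ^ 9 * ‖Sj c' D 1 a b‖) + 2 * (ell D ^ 9 * ‖Sj c' D 2 a b‖) +
            3 / 2 * (ell D ^ 9 * ‖Sj c' D 3 a b‖) := by rw [hn1, hn2, hn3]; ring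
      _ ≤ 1 / 2 * ε₂ + 2 * ε₂ + 3 / 2 * ε₂ := by linarith
      _ = 4 * ε₂ := by ring
  have hmain : 2 * ‖mainMV c' D a b‖ ≤ 3 * ε₂ * frakP D := by
    rw [mainMV, hα, norm_mul, norm_mul, Complex.norm_real, Real.norm_of_nonneg hP, norm_inv,
      Complex.norm_real, Real.norm_of_nonneg (by positivity)]
    have hinv : (π / ell D ^ 9)⁻¹ = ell D ^ 9 / π := by rw [inv_div]
    rw [hinv]
    have hπ3 : (3 : ℝ) < π := Real.pi_gt_three
    have h1 : 2 * (ell D ^ 9 / π * ‖1 / 2 * Sj c' D 1 a b + 2 * Sj c' D 2 a b +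
        3 / 2 * Sj c' D 3 a b‖) ≤ 3 * ε₂ := by
      rw [show 2 * (ell D ^ 9 / π * ‖1 / 2 * Sj c' D 1 a b + 2 * Sj c' D 2 a b +
          3 / 2 * Sj c' D 3 a b‖) = 2 / π * (ell D ^ 9 * ‖1 / 2 * Sj c' D 1 a b +
          2 * Sj c' D 2 a b + 3 / 2 * Sj c' D 3 a b‖) by ring]
      calc 2 / π * (ell D ^ 9 * ‖1 / 2 * Sj c' D 1 a b + 2 * Sj c' D 2 a b +
            3 / 2 * Sj c' D 3 a b‖) ≤ 2 / π * (4 * ε₂) :=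
            mul_le_mul_of_nonneg_left hsum (by positivity)
        _ ≤ 3 * ε₂ := by
            rw [div_mul_eq_mul_div, div_le_iff₀ Real.pi_pos]; nlinarith
    calc 2 * (ell D ^ 9 / π * ‖1 / 2 * Sj c' D 1 a b + 2 * Sj c' D 2 a b +
          3 / 2 * Sj c' D 3 a b‖ * frakP D)
        = 2 * (ell D ^ 9 / π * ‖1 / 2 * Sj c' D 1 a b + 2 * Sj c' D 2 a b +
          3 / 2 * Sj c' D 3 a b‖) * frakP D := by ring
      _ ≤ 3 * ε₂ * frakP D := mul_le_mul_of_nonneg_right h1 hP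
  -- the `E`-term
  have hE : Ecal c' D a b ≤ 3 * ε₂ * frakP D := by
    rw [Ecal]
    have h7 : 1 ≤ ell D ^ 7 := one_le_pow₀ (by linarith)
    have hj : ∀ j : ℕ, ell D ^ 9 * ‖Sj c' D j a b‖ ≤ ε₂ → ell D ^ 2 * ‖Sj c' D j a b‖ ≤ ε₂ := by
      intro j hj
      calc ell D ^ 2 * ‖Sj c' D j a b‖ ≤ ell D ^ 2 * ‖Sj c' D j a b‖ * ell D ^ 7 :=
            le_mul_of_one_le_right (by positivity) h7
        _ = ell D ^ 9 * ‖Sj c' D j a b‖ := by ring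
        _ ≤ ε₂ := hj
    have e1 := hj 1 hS1
    have e2 := hj 2 hS2
    have e3 := hj 3 hS3
    calc frakP D * ell D ^ 2 * (‖Sj c' D 1 a b‖ + ‖Sj c' D 2 a b‖ + ‖Sj c' D 3 a b‖)
        = (ell D ^ 2 * ‖Sj c' D 1 a b‖ + ell D ^ 2 * ‖Sj c' D 2 a b‖ +
            ell D ^ 2 * ‖Sj c' D 3 a b‖) * frakP D := by ring
      _ ≤ (ε₂ + ε₂ + ε₂) * frakP D := mul_le_mul_of_nonneg_right (by linarith) hP
      _ = 3 * ε₂ * frakP D := by ring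
  have hCE : C * Ecal c' D a b ≤ C * (3 * ε₂ * frakP D) := mul_le_mul_of_nonneg_left hE hC0
  have hkey : (3 + 3 * C) * ε₂ = ε * a₀ / 3 := by
    rw [hε₂]; field_simp
  have ht : 0 ≤ ε * a₀ * frakP D := by positivity
  calc ∑ i ∈ idx χ, (cstar c' D i.1 i.2).re * ‖Apoly i.1 a i.2‖ ^ 2 * (omegaW D i.2).re
      ≤ 2 * ‖mainMV c' D a b‖ + C * Ecal c' D a b + ε * a₀ / 3 * frakP D := k
    _ ≤ 3 * ε₂ * frakP D + C * (3 * ε₂ * frakP D) + ε * a₀ / 3 * frakP D := by linarith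
    _ = ((3 + 3 * C) * ε₂ + ε * a₀ / 3) * frakP D := by ring
    _ = 2 * (ε * a₀) / 3 * frakP D := by rw [hkey]; ring
    _ ≤ ε * a₀ * frakP D := by linarith
    _ ≤ ε * frakA χ * frakP D := by gcongr

end General

/-! ### Sizes: the windows lie below `PT⁻²` -/

section Sizes

variable (D : ℕ)

/-- For `𝓛 ≥ 2`: `P₁η₊ < PT⁻²` (`0.504𝓛⁹ + 𝓛⁻¹⁰ < 𝓛⁹ − 2𝓛^{1.1}`).
[cite: Zhang2022LandauSiegel, §7 (7.2); §11 p. 64] -/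
theorem P1_mul_etaPM_lt_P_div_T_sq (hD : 2 ≤ Real.log D) :
    Skeleton.P1 D * etaPM D 1 < bigP D / bigT D ^ 2 := by
  have hℓ : 2 ≤ ell D := by rw [ell]; exact hD
  have h1 : (1 : ℝ) ≤ ell D := by linarith
  have h0 : (0 : ℝ) < ell D := by linarith
  rw [Skeleton.P1, etaPM, bigP, bigT, ← Real.exp_mul, ← Real.exp_nat_mul, ← Real.exp_add,
    ← Real.exp_sub, Real.exp_lt_exp]
  have h11 : ell D ^ (1.1 : ℝ) ≤ ell D ^ (2 : ℝ) :=
    Real.rpow_le_rpow_of_exponent_le h1 (by norm_num)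
  rw [Real.rpow_two] at h11
  have hinv : (ell D ^ 10)⁻¹ ≤ 1 := inv_le_one_of_one_le₀ (one_le_pow₀ h1)
  have h7 : (128 : ℝ) ≤ ell D ^ 7 := by
    calc (128 : ℝ) = 2 ^ 7 := by norm_num
      _ ≤ ell D ^ 7 := pow_le_pow_left₀ (by norm_num) hℓ 7
  have h9 : 128 * ell D ^ 2 ≤ ell D ^ 9 := by
    have := mul_le_mul_of_nonneg_left h7 (pow_nonneg h0.le 2)
    calc 128 * ell D ^ 2 = ell D ^ 2 * 128 := by ring
      _ ≤ ell D ^ 2 * ell D ^ 7 := this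
      _ = ell D ^ 9 := by ring
  have h4 : (4 : ℝ) ≤ ell D ^ 2 := by nlinarith
  push_cast
  nlinarith

/-- Members of `𝔍₁ ∩ ℕ` are positive and `< P₁η₊` (`P^a ≤ P^{0.504}` for `a ≤ 0.504`, `P ≥ 1`).
[cite: Zhang2022LandauSiegel, §11 p. 64] -/
theorem pos_and_lt_of_mem_frakI1Nat {n : ℕ} (hn : n ∈ frakI1Nat D) :
    0 < n ∧ (n : ℝ) < Skeleton.P1 D * etaPM D 1 := by
  rw [mem_frakI1Nat_iff, mem_frakI1_iff] at hn
  obtain ⟨a, ha, h1, h2⟩ := hn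
  have hP1 : 1 ≤ bigP D := Real.one_le_exp (pow_nonneg (Real.log_natCast_nonneg D) 9)
  have hP0 : 0 < bigP D := Real.exp_pos _
  have ha' : a ≤ 0.504 := by
    simp only [Finset.mem_insert, Finset.mem_singleton] at ha
    rcases ha with rfl | rfl | rfl <;> norm_num
  have hlow : (0 : ℝ) < n := lt_trans (mul_pos (Real.rpow_pos_of_pos hP0 a) (Real.exp_pos _)) h1
  refine ⟨by exact_mod_cast hlow, lt_of_lt_of_le h2 ?_⟩
  exact mul_le_mul_of_nonneg_right (Real.rpow_le_rpow_of_exponent_le hP1 ha') (Real.exp_pos _).le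

/-- For `𝓛 ≥ 2`, members of `𝔍₁ ∩ ℕ` are `< PT⁻²`, hence inside the truncation `n < ⌈PT⁻²⌉` of
`A(𝐚;s,ψ)`. [cite: Zhang2022LandauSiegel, §7 (7.2); §11 p. 64] -/
theorem lt_P_div_T_sq_of_mem_frakI1Nat (hD : 2 ≤ Real.log D) {n : ℕ} (hn : n ∈ frakI1Nat D) :
    (n : ℝ) < bigP D / bigT D ^ 2 :=
  (pos_and_lt_of_mem_frakI1Nat D hn).2.trans (P1_mul_etaPM_lt_P_div_T_sq D hD)

/-- For `𝓛 ≥ 2`: `𝔍₁ ∩ ℕ ⊆ [0, ⌈PT⁻²⌉)`. [cite: Zhang2022LandauSiegel, §7 (7.2); §11 p. 64] -/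
theorem frakI1Nat_subset_range (hD : 2 ≤ Real.log D) : frakI1Nat D ⊆ Finset.range (Nsupp D) := by
  intro n hn
  rw [Finset.mem_range, Nsupp]
  exact Nat.lt_ceil.mpr (lt_P_div_T_sq_of_mem_frakI1Nat D hD hn)

/-- **`|g̃₁(y)| ≤ 2`**: both `z`-integrals of `0 < g < 1` over intervals of length `0.002` are at most
`0.002` in modulus (`𝓛 > 0`). [cite: Zhang2022LandauSiegel, §11 p. 62; §4 (4.1)] -/
theorem abs_gtilde1_le_two (hL : 0 < ell D) (y : ℝ) : |gtilde1 D y| ≤ 2 := by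
  have hΛ : 0 < ell D ^ 30 := pow_pos hL 30
  have hg : ∀ u : ℝ, ‖gW D u‖ ≤ 1 := fun u => by
    rw [gW, Real.norm_of_nonneg (GaussWeight.gWeight_pos hΛ u).le]
    exact (GaussWeight.gWeight_lt_one hΛ u).le
  have h1 : ‖∫ z in (0.5 : ℝ)..0.502, gW D (bigP D ^ z / y)‖ ≤ 1 * |(0.502 : ℝ) - 0.5| :=
    intervalIntegral.norm_integral_le_of_norm_le_const fun z _ => hg _
  have h2 : ‖∫ z in (0.502 : ℝ)..0.504, gW D (bigP D ^ z / y)‖ ≤ 1 * |(0.504 : ℝ) - 0.502| :=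
    intervalIntegral.norm_integral_le_of_norm_le_const fun z _ => hg _
  have e1 : (1 : ℝ) * |(0.502 : ℝ) - 0.5| = 2 / 1000 := by norm_num
  have e2 : (1 : ℝ) * |(0.504 : ℝ) - 0.502| = 2 / 1000 := by norm_num
  rw [Real.norm_eq_abs, e1] at h1
  rw [Real.norm_eq_abs, e2] at h2
  rw [gtilde1]
  calc |-500 * (∫ z in (0.5 : ℝ)..0.502, gW D (bigP D ^ z / y)) +
        500 * (∫ z in (0.502 : ℝ)..0.504, gW D (bigP D ^ z / y))|
      ≤ |-500 * (∫ z in (0.5 : ℝ)..0.502, gW D (bigP D ^ z / y))| +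
        |500 * (∫ z in (0.502 : ℝ)..0.504, gW D (bigP D ^ z / y))| := abs_add_le _ _
    _ = 500 * |∫ z in (0.5 : ℝ)..0.502, gW D (bigP D ^ z / y)| +
        500 * |∫ z in (0.502 : ℝ)..0.504, gW D (bigP D ^ z / y)| := by
        rw [abs_mul, abs_mul]; norm_num
    _ ≤ 500 * (2 / 1000) + 500 * (2 / 1000) := by gcongr
    _ = 2 := by norm_num

end Sizes

/-! ### The window sequence of `Z22:§11.u019` as a sequence admissible for (7.2) -/

section Window

variable {D : ℕ} [NeZero D] (χ : DirichletCharacter ℂ D) (x : Chr D)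

omit [NeZero D] in
/-- **The window sequence `𝐚(n) = χ(n)1_{𝔍₁}(n)(f̃(log n/log P) − g̃₁(n))` is admissible for (7.2)
with `B = 3`** (`|χ| ≤ 1`, `|f̃| ≤ 1`, `|g̃₁| ≤ 2`; it vanishes from `PT⁻²` on since `𝔍₁ ⊂ (0, P₁η₊)`
and `P₁η₊ < PT⁻²` for `𝓛 ≥ 2`). [cite: Zhang2022LandauSiegel, §7 (7.2); §11 p. 64] -/
theorem adm72_window (hD : 2 ≤ Real.log D) :
    Adm72 D 3 (fun n : ℕ => if n ∈ frakI1Nat D then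
      χ (n : ZMod D) * (((ftilde (Real.log n / Real.log (bigP D)) : ℝ) : ℂ) - ((gtilde1 D n : ℝ) : ℂ))
      else 0) := by
  have hL : 0 < ell D := by rw [ell]; linarith
  refine ⟨fun n => ?_, fun n hn => ?_⟩ <;> dsimp only
  · by_cases h : n ∈ frakI1Nat D
    · rw [if_pos h, norm_mul]
      have hχ : ‖χ (n : ZMod D)‖ ≤ 1 := DirichletCharacter.norm_le_one _ _
      have hw : ‖(((ftilde (Real.log n / Real.log (bigP D)) : ℝ) : ℂ) - ((gtilde1 D n : ℝ) : ℂ))‖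
          ≤ 3 := by
        calc _ ≤ ‖((ftilde (Real.log n / Real.log (bigP D)) : ℝ) : ℂ)‖ + ‖((gtilde1 D n : ℝ) : ℂ)‖ :=
              norm_sub_le _ _
          _ = |ftilde (Real.log n / Real.log (bigP D))| + |gtilde1 D n| := by
              rw [Complex.norm_real, Complex.norm_real, Real.norm_eq_abs, Real.norm_eq_abs]
          _ ≤ 1 + 2 := add_le_add (abs_ftilde_le_one _) (abs_gtilde1_le_two D hL _)
          _ = 3 := by norm_num
      calc ‖χ (n : ZMod D)‖ *
            ‖(((ftilde (Real.log n / Real.log (bigP D)) : ℝ) : ℂ) - ((gtilde1 D n : ℝ) : ℂ))‖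
          ≤ 1 * 3 := mul_le_mul hχ hw (norm_nonneg _) zero_le_one
        _ = 3 := by norm_num
    · rw [if_neg h, norm_zero]; norm_num
  · rw [if_neg]
    intro h
    have := lt_P_div_T_sq_of_mem_frakI1Nat D hD h
    linarith

omit [NeZero D] in
/-- **`A(𝐚;s,ψ) = Σ_{n∈𝔍₁} χψ(n)n^{−s}(f̃(log n/log P) − g̃₁(n))`** for the window sequence `𝐚`
(`𝓛 ≥ 2`, so that `𝔍₁ ∩ ℕ` lies inside the truncation of `A`): the Dirichlet polynomial of
`Z22:§11.u019` IS `Typed.TypedSection11B.frakI1Sum`. [cite: Zhang2022LandauSiegel, §11 (11.5), p. 64] -/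
theorem Apoly_window_eq_frakI1Sum (hD : 2 ≤ Real.log D) (s : ℂ) :
    Apoly x (fun n : ℕ => if n ∈ frakI1Nat D then
      χ (n : ZMod D) * (((ftilde (Real.log n / Real.log (bigP D)) : ℝ) : ℂ) - ((gtilde1 D n : ℝ) : ℂ))
      else 0) s = frakI1Sum χ x s := by
  rw [Apoly, Lemma81.dirPoly_def, frakI1Sum, ← Finset.sum_subset (frakI1Nat_subset_range D hD)]
  · refine Finset.sum_congr rfl fun n hn => ?_
    rw [if_pos hn, pc]
    ring
  · intro n _ hn
    rw [if_neg hn]; ring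

end Window

/-! ### `Z22:§11.u019` reduced to an estimate of `S_j` at the window sequence -/

section Reduction

variable (c' : ℝ)

/-- **`Z22:§11.u019` from an `S_j`-estimate** (the mean-value half of "by (11.3), (8.25) and
(8.26)"): Lemma 2.3, Prop. 2.2 (i), Lemma 8.1, Prop. 7.1, `𝔞 ≫ 1`, and
"`𝓛⁹·S_j(𝐚,𝐚̄) → 0` (`j = 1,2,3`) for the window sequence `𝐚 = χ·1_{𝔍₁}·(f̃(log ·/log P) − g̃₁)`"
imply `ΣΣ𝔠*|Σ_{n∈𝔍₁}χψ(n)n^{−ρ}(f̃ − g̃₁)(n)|²ω = o(𝔞𝔓)`.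
[cite: Zhang2022LandauSiegel, §11 p. 64, tex L3295–L3301] -/
theorem step11u019_of_sjWindow (h23 : Lemma23 c') (h22 : Prop22i) (h81 : Lemma81 c')
    (h71 : Prop71 c') (ha : FrakALowerBound)
    (hS : ∀ ε : ℝ, 0 < ε → ForAllLarge fun D _ χ => AssumptionA D χ →
      ∀ j ∈ ({1, 2, 3} : Finset ℕ), ell D ^ 9 * ‖Sj c' D j
        (fun n : ℕ => if n ∈ frakI1Nat D then χ (n : ZMod D) *
          (((ftilde (Real.log n / Real.log (bigP D)) : ℝ) : ℂ) - ((gtilde1 D n : ℝ) : ℂ)) else 0)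
        (fun n : ℕ => conj (if n ∈ frakI1Nat D then χ (n : ZMod D) *
          (((ftilde (Real.log n / Real.log (bigP D)) : ℝ) : ℂ) - ((gtilde1 D n : ℝ) : ℂ)) else 0))‖
        ≤ ε) :
    Step11u019 c' := by
  have hadm : ForAllLarge fun D _ χ => Adm72 D 3 (fun n : ℕ => if n ∈ frakI1Nat D then
      χ (n : ZMod D) * (((ftilde (Real.log n / Real.log (bigP D)) : ℝ) : ℂ) - ((gtilde1 D n : ℝ) : ℂ))
      else 0) :=
    ⟨8, fun D _ χ hD _ _ => adm72_window χ (two_le_log_of_eight_le hD)⟩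
  have hcore := meanSquare_small_of_sj c' h23 h22 h81 h71 ha 3 (fun D χ n =>
    if n ∈ frakI1Nat D then χ (n : ZMod D) *
      (((ftilde (Real.log n / Real.log (bigP D)) : ℝ) : ℂ) - ((gtilde1 D n : ℝ) : ℂ)) else 0) hadm hS
  intro ε hε
  obtain ⟨D₀, h⟩ := hcore ε hε
  refine ⟨max D₀ 8, fun D _ χ hD hq hp hA => ?_⟩
  have hlog := two_le_log_of_eight_le (le_trans (le_max_right _ _) hD)
  have h' := h D χ (le_trans (le_max_left _ _) hD) hq hp hA
  calc ∑ i ∈ idx χ, (cstar c' D i.1 i.2).re * ‖frakI1Sum χ i.1 i.2‖ ^ 2 * (omegaW D i.2).re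
      = ∑ i ∈ idx χ, (cstar c' D i.1 i.2).re * ‖Apoly i.1 (fun n : ℕ => if n ∈ frakI1Nat D then
          χ (n : ZMod D) * (((ftilde (Real.log n / Real.log (bigP D)) : ℝ) : ℂ) -
            ((gtilde1 D n : ℝ) : ℂ)) else 0) i.2‖ ^ 2 * (omegaW D i.2).re := by
        refine Finset.sum_congr rfl fun i _ => ?_
        rw [Apoly_window_eq_frakI1Sum χ i.1 hlog]
    _ ≤ ε * frakA χ * frakP D := h'

/-- **`Z22:§11.u019` from the `S_j`-estimate alone, for every sufficiently large `c′`**: the five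
§2/§7/§8 inputs are tree theorems (`Skeleton.lemma23_eventually`, `prop22i_holds`,
`lemma81_eventually`, `Section7cStatements.prop71X_holds`, `frakALowerBound_holds`).
[cite: Zhang2022LandauSiegel, §11 p. 64, tex L3295–L3301] -/
theorem step11u019_of_sjWindow_eventually :
    ∃ c₀ : ℝ, 0 ≤ c₀ ∧ ∀ c' : ℝ, c₀ ≤ c' →
      (∀ ε : ℝ, 0 < ε → ForAllLarge fun D _ χ => AssumptionA D χ →
        ∀ j ∈ ({1, 2, 3} : Finset ℕ), ell D ^ 9 * ‖Sj c' D j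
          (fun n : ℕ => if n ∈ frakI1Nat D then χ (n : ZMod D) *
            (((ftilde (Real.log n / Real.log (bigP D)) : ℝ) : ℂ) - ((gtilde1 D n : ℝ) : ℂ)) else 0)
          (fun n : ℕ => conj (if n ∈ frakI1Nat D then χ (n : ZMod D) *
            (((ftilde (Real.log n / Real.log (bigP D)) : ℝ) : ℂ) - ((gtilde1 D n : ℝ) : ℂ)) else 0))‖
          ≤ ε) →
      Step11u019 c' := by
  obtain ⟨c₁, h1, h23⟩ := lemma23_eventually
  obtain ⟨c₂, -, h81⟩ := lemma81_eventually
  exact ⟨max c₁ c₂, le_trans h1 (le_max_left _ _), fun c' hc' hS =>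
    step11u019_of_sjWindow c' (h23 c' ((le_max_left _ _).trans hc')) prop22i_holds
      (h81 c' ((le_max_right _ _).trans hc')) (Section7cStatements.prop71X_holds c')
      frakALowerBound_holds hS⟩

end Reduction

end Literature.NumberTheory.LFunctions.Zhang2022.Section11WindowMeanSquare
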